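import Summits.BirchSwinnertonDyer.BirchSwinnertonDyer.Theorems.InertBadSignedBranchesInertBadAtThreeOfKatzLineDivisibility
import Summits.BirchSwinnertonDyer.BirchSwinnertonDyer.Theorems.BiquadraticEisensteinDescentDeuringRowZeroHolds
import HarnessLib

set_option linter.dupNamespace false -- `Summit.BirchSwinnertonDyer.BirchSwinnertonDyer.Theorems.…` (summit = sub, D-0017)
set_option autoImplicit false

/-!
# Crux `InertBadAtThree` (stmt-BirchSwinnertonDyer-19225), line `rubin_e1_inert_three` v8 (f92f96d92210f066): the crux MODULO
# NINETEEN named print facts + V4K@3 — Deuring's Grössencharacter theorem is no longer a hypothesis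

Route `InertBadSignedBranches` / `BiquadraticEisensteinDescent` (cell `pub/bsd-wall`, width seat `bsd-wall-cm-bed-w4` g19). THEOREMS ONLY;
supports, does not close, stmt-BirchSwinnertonDyer-19225 (HOLD; `--supports` filings welcome per the hold note). The lead's one-theorem form
of the line (ibd-p1 g9, `…InertBadAtThreeOfKatzLineDivisibility.inertBadAtThree_of_print_of_katzLineDivisibilityAtThree` /
`bsdp_three_of_print_of_katzLineDivisibilityAtThree`: twenty named print facts ONE PER HYPOTHESIS + the registered research stub
`stub_katzLineDivisibilityAtThree` VERBATIM as `hV4K`) with the hypothesis `hD : Deuring_exists_heckeCharacter_of_maximalCM` (group (E),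
second conjunct of the skeleton's HELD `PrintedInputsAtThreeMin`) DISCHARGED by the kernel theorem
`…DeuringOfCore.Deuring_exists_heckeCharacter_of_maximalCM_holds` (p698052, «Deuring-ψ lane» of the BED width seats). After this file the
conditional closure of record of crux 19225 reads PRINT{19 named facts} + RESEARCH{V4K@3}; the binder lists are the originals VERBATIM minus
`hD`. HONEST STATUS: conditional (`proof.conditional`); V4K@3 is NOT asserted; nothing about any case of BSD is asserted; 19225 stays OPEN
(HOLD). For the line's lead: a v9 of the skeleton may drop conjunct (E).2 of `PrintedInputsAtThreeMin` against this name.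
-/

noncomputable section

open scoped MatrixGroups ModularForm Classical NumberField

open CongruenceSubgroup WeierstrassCurve Literature.NumberTheory.EllipticCurves Literature.NumberTheory.EllipticCurves.Rank1Residual
  Literature.NumberTheory.EllipticCurves.ModularForms

namespace Summit.BirchSwinnertonDyer.BirchSwinnertonDyer.Theorems.InertBadSignedBranchesInertBadAtThreeOfKatzLineDivisibilityOfKatz

open Summit.BirchSwinnertonDyer.BirchSwinnertonDyer.Theses
open Summit.BirchSwinnertonDyer.BirchSwinnertonDyer.Theorems
open Summit.BirchSwinnertonDyer.Rank1Residual

open NumberField IsDedekindDomain Field PowerSeries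
  Literature.NumberTheory.EllipticCurves.Hsieh2014
  Literature.NumberTheory.EllipticCurves.GreenbergSelmer
  Literature.NumberTheory.EllipticCurves.Module
  Literature.NumberTheory.EllipticCurves.IwasawaDual
  Literature.NumberTheory.GaloisRepresentations
  Summit.BirchSwinnertonDyer.Rank1Residual.X11b
  Summit.BirchSwinnertonDyer.Rank1Residual.X11b.AcSelmer
  Summit.BirchSwinnertonDyer.BirchSwinnertonDyer.Theorems.BiquadraticEisensteinDescentDefs
  Summit.BirchSwinnertonDyer.BirchSwinnertonDyer.Theorems.BiquadraticEisensteinDescentEisensteinHeartFlatCMInertBadKPrimeSelmerTower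
  Summit.BirchSwinnertonDyer.BirchSwinnertonDyer.Theorems.BiquadraticEisensteinDescentEisensteinHeartFlatCMInertBadKPrimeShapiroDatum
  Summit.BirchSwinnertonDyer.BirchSwinnertonDyer.Theorems.BiquadraticEisensteinDescentEisensteinHeartFlatCMInertBadKPrimeCMDatumAdapter

/-- **BSD(E,3) for every CM curve of analytic rank one with CM-inert bad `3`, MODULO nineteen named print facts and V4K@3** —
`bsdp_three_of_print_of_katzLineDivisibilityAtThree` (p640483) with Deuring's theorem supplied by `Deuring_exists_heckeCharacter_of_maximalCM_holds`.
[cite: Hsieh2014JAMS, Thm. 8.14] [cite: Hsieh2014, Thm. A and Thm. B p. 712 (Doc. Math. 19)] [cite: Katz1978, Thm. (5.3.0)] -/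
theorem bsdp_three_of_print_of_katzLineDivisibilityAtThree_of_katz
    (hGZ : ∀ (N : ℕ) [NeZero N] (W : WeierstrassCurve ℚ) (K : Type) [Field K] [NumberField K],
      Literature.NumberTheory.EllipticCurves.gross_zagier N W K)
    (hKo : ∀ (N : ℕ) [NeZero N] (W : WeierstrassCurve ℚ) (K : Type) [Field K] [NumberField K],
      Literature.NumberTheory.EllipticCurves.kolyvagin N W K)
    (hMN : ∀ (N : ℕ) [NeZero N] (W : WeierstrassCurve ℚ) (K : Type) [Field K] [NumberField K],
      Literature.NumberTheory.EllipticCurves.MatarNekovar2019.thm03_padicValNat_card_sha_le_of_irreducible N W K)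
    (hGZK : Literature.NumberTheory.EllipticCurves.rank_eq_analyticRank_of_analyticRank_le_one)
    (hnf : Literature.NumberTheory.EllipticCurves.ModularForms.exists_isNewformOf)
    (hFH : Literature.NumberTheory.EllipticCurves.friedbergHoffstein_exists_heegnerField_split_twist_ne_zero)
    (hCM8 : Literature.NumberTheory.EllipticCurves.bsdTriple_of_hasCM_of_L_one_ne_zero)
    (hCassels : WeierstrassCurve.bsdRHS_eq_of_isIsogenous)
    (h8 : Literature.NumberTheory.EllipticCurves.Hsieh2014.thmA_exists_isHsiehLFunction_unrPeriod_anyLevel)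
    (h9 : Literature.NumberTheory.EllipticCurves.Hsieh2014.thmB_exists_isHsiehLFunction_coeff_norm_eq_one_unrPeriod_anyLevel)
    (h10 : Literature.NumberTheory.EllipticCurves.LiuZhangZhang2018.thm151_thm153_modularCurve_heegnerVector_additive)
    (hBT : Literature.NumberTheory.EllipticCurves.burungaleTian_analyticRank_eq_zero_of_selmerCorank_eq_zero_of_hasCM)
    (hMon : Literature.NumberTheory.EllipticCurves.monsky_selmerCorank_two_mod_two_eq)
    (hSmith : ∀ (W : WeierstrassCurve ℚ) [W.IsElliptic], W.HasCM →
      Literature.NumberTheory.EllipticCurves.smith_selmerCorank_density W)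
    (hBV : Literature.NumberTheory.QuadraticFields.bv_threeTorsion_mean_imaginary_heegnerOdd)
    (hMaz : Literature.NumberTheory.EllipticCurves.ModularForms.mazur_not_dvd_maninConstant_of_odd)
    (hAU : Literature.NumberTheory.EllipticCurves.ModularForms.abbesUllmo_not_dvd_maninConstant_of_not_dvd_level)
    (hCes : Literature.NumberTheory.EllipticCurves.ModularForms.cesnavicius_not_two_dvd_maninConstant_of_two_dvd_level)
    (hKatz : Literature.NumberTheory.EllipticCurves.hsieh2014mu_prop49_exists_isMeasure)
    (hV4K :
    ∀ (W : WeierstrassCurve ℚ) [W.IsElliptic] [W.IsGloballyMinimal] (p : ℕ) [Fact p.Prime]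
      [NeZero (W.conductorNorm ℤ)] (K : Type) [Field K] [NumberField K],
      W.HasCM → p = 3 → CMInert W p → ¬ Good W p →
      IsImaginaryQuadratic K → SatisfiesHeegnerHypothesis (W.conductorNorm ℤ) K →
      4 < (NumberField.discr K).natAbs → ¬ p ∣ NumberField.classNumber K →
      ∀ (κ : ZpExtension K p), κ.IsAnticyclotomic →
        ∀ (γ : Field.absoluteGaloisGroup K) [Fact (κ.IsTopGenerator γ)]
          (𝔭 : HeightOneSpectrum (𝓞 K)), ((p : ℕ) : 𝓞 K) ∈ 𝔭.asIdeal →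
          𝔭.asIdeal.ramificationIdx (𝓞 ℚ) = 1 → 𝔭.asIdeal.inertiaDeg (𝓞 ℚ) = 1 →
          ∀ (f : CuspForm (CongruenceSubgroup.Gamma0 (W.conductorNorm ℤ)) 2), IsNewformOf W f →
            ∀ (ι' : PadicAlgCl p ≃+* ℂ),
              (∀ (w : InfinitePlace K) (k : 𝓞 K), k ∈ 𝔭.asIdeal ↔ ‖ι'.symm (w.embedding (k : K))‖ < 1) →
                  ∀ (𝔭' : HeightOneSpectrum (𝓞 K)), ((p : ℕ) : 𝓞 K) ∈ 𝔭'.asIdeal → 𝔭' ≠ 𝔭 →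
                  Module.IsTorsion (IwasawaAlgebra p) (XAc (W.baseChange K) p κ 𝔭' ∅ γ) →
                  ∀ (L : Type) [Field L] [NumberField L] [Algebra K L] [IsGalois K L]
                    (Sp S T : Finset (HeightOneSpectrum (𝓞 L))) (lam : HeckeCharacter L) (ϑ : L) (CK : ℂ)
                    (Ω : InfinitePlace L → ℂ) (ΩpK : InfinitePlace L → ℂ_[p]) (G : PowerSeries 𝓞_ℂ_[p])
                    (w₁ w₂ : InfinitePlace L) (cL cL' : ℂ),
                    w₁ ≠ w₂ → (∀ w : InfinitePlace L, w = w₁ ∨ w = w₂) →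
                    (∀ (χ : HeckeCharacter K) (n : ℕ), 0 < n → (∀ v : HeightOneSpectrum (𝓞 K), χ.IsUnramifiedAt v) →
                      χ.HasInfinityType (fun _ ↦ (n : ℤ)) (fun _ ↦ -(n : ℤ)) →
                      KatzCM.HasKatzType ι' Sp (lam * χ.compRelNorm L) 1 (fun w ↦ if w = w₁ then n else n - 1)) →
                    (∀ (χ : HeckeCharacter K) (n : ℕ), 0 < n → (∀ v : HeightOneSpectrum (𝓞 K), χ.IsUnramifiedAt v) →
                      χ.HasInfinityType (fun _ ↦ (n : ℤ)) (fun _ ↦ -(n : ℤ)) →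
                      LFunction.HasEntireContinuation (heckeLFunction (lam * χ.compRelNorm L))) →
                    cL ≠ 0 → cL' ≠ 0 →
                    (∀ (χ : HeckeCharacter K) (n : ℕ), 0 < n → (∀ v : HeightOneSpectrum (𝓞 K), χ.IsUnramifiedAt v) →
                      χ.HasInfinityType (fun _ ↦ (n : ℤ)) (fun _ ↦ -(n : ℤ)) →
                      ∀ hL : LFunction.HasEntireContinuation (heckeLFunction (lam * χ.compRelNorm L)),
                        hL.continuation 0 = cL * cL' ^ n * rankinSelbergValueHecke f χ 1) →
                    (∀ w ∈ S ∪ KatzCM.primesOver L p, ¬ lam.IsUnramifiedAt w) →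
                    (∀ w ∈ Sp ∪ T, ¬ lam.IsUnramifiedAt w) →
                    CK ≠ 0 → (∀ w, Ω w ≠ 0) → (∀ w, (KatzCM.embeddingAt ι' Sp w ϑ).im ≠ 0) → (∀ w, ΩpK w ≠ 0) →
                    KatzCM.IsBaseChangeLine ι' Sp S T κ γ lam ϑ CK Ω ΩpK G →
                  ∀ (d₀ : ℤ) (r : AlgebraicClosure K) (ψ : (W.baseChange K).geomPoints →+ (W.baseChange K).geomPoints),
                    r * r = algebraMap K (AlgebraicClosure K) (d₀ : K) →
                    r ∉ Set.range (algebraMap K (AlgebraicClosure K)) →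
                    (∀ y : ZMod p, y * y ≠ PadicInt.toZMod ((d₀ : ℤ) : ℤ_[p])) →
                    (∀ σ : absoluteGaloisGroup K, σ • r = r → ∀ P : (W.baseChange K).geomPoints, σ • ψ P = ψ (σ • P)) →
                    (∀ σ : absoluteGaloisGroup K, σ • r = -r → ∀ P : (W.baseChange K).geomPoints, σ • ψ P = -ψ (σ • P)) →
                    (∀ P, ψ (ψ P) = d₀ • P) →
                  ∀ (U : Subgroup (absoluteGaloisGroup K)) [U.Normal], (∀ σ, σ ∈ U ↔ σ • r = r) →
                  ∀ (φ : (W.baseChange K).geomPrimaryTorsion p →+ (W.baseChange K).geomPrimaryTorsion p)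
                    (_ : ∀ m, ((φ m : (W.baseChange K).geomPrimaryTorsion p) : (W.baseChange K).geomPoints) = ψ m)
                    (hφH' : ∀ (x : (κ.kerSubgroup ⊓ U : Subgroup (absoluteGaloisGroup K)))
                      (m : (W.baseChange K).geomPrimaryTorsion p), φ (x • m) = x • φ m)
                    (hφU : ∀ σ ∈ U, ∀ m : (W.baseChange K).geomPrimaryTorsion p, φ (σ • m) = σ • φ m)
                    (hφU' : ∀ σ, σ ∉ U → ∀ m : (W.baseChange K).geomPrimaryTorsion p, φ (σ • m) = -(σ • φ m))
                    (hφ2 : ∀ m, φ (φ m) = d₀ • m)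
                    (γ' : absoluteGaloisGroup K) (_ : κ.IsTopGenerator γ') (_ : γ' ∈ U)
                    (f₁ : AddMonoid.End (selmerOver (κ.kerSubgroup ⊓ U) ((W.baseChange K).geomPrimaryTorsion p) p 𝔭' ∅))
                    (_hf : ∀ s, ((f₁ s : selmerOver (κ.kerSubgroup ⊓ U) ((W.baseChange K).geomPrimaryTorsion p) p 𝔭' ∅) :
                      subgroupH1 (κ.kerSubgroup ⊓ U) ((W.baseChange K).geomPrimaryTorsion p)) =
                        conjH1 (κ.kerSubgroup ⊓ U) ((W.baseChange K).geomPrimaryTorsion p) γ' s)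
                    (h : IsLocNil p (f₁ - 1))
                    (δ : LocNilDual (selmerOver (κ.kerSubgroup ⊓ U) ((W.baseChange K).geomPrimaryTorsion p) p 𝔭' ∅) f₁ h
                      →ₗ[IwasawaAlgebra p]
                      LocNilDual (selmerOver (κ.kerSubgroup ⊓ U) ((W.baseChange K).geomPrimaryTorsion p) p 𝔭' ∅) f₁ h)
                    (hδ : ∀ (x : LocNilDual (selmerOver (κ.kerSubgroup ⊓ U) ((W.baseChange K).geomPrimaryTorsion p) p 𝔭' ∅) f₁ h)
                      (s t : selmerOver (κ.kerSubgroup ⊓ U) ((W.baseChange K).geomPrimaryTorsion p) p 𝔭' ∅),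
                      (t : subgroupH1 (κ.kerSubgroup ⊓ U) ((W.baseChange K).geomPrimaryTorsion p)) =
                        resH1Hom (ContinuousMonoidHom.id _) φ hφH'
                          (s : subgroupH1 (κ.kerSubgroup ⊓ U) ((W.baseChange K).geomPrimaryTorsion p)) → δ x s = x t)
                    (b : Module.Basis (Fin 2) ℤ_[p]
                      (AdjoinRoot (Polynomial.X ^ 2 - Polynomial.C ((d₀ : ℤ) : ℤ_[p]) : Polynomial ℤ_[p]))) (hb0 : b 0 = 1)
                    (hb1 : b 1 * b 1 = algebraMap ℤ_[p]
                      (AdjoinRoot (Polynomial.X ^ 2 - Polynomial.C ((d₀ : ℤ) : ℤ_[p]) : Polynomial ℤ_[p])) ((d₀ : ℤ) : ℤ_[p]))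
                    (ι : AdjoinRoot (Polynomial.X ^ 2 - Polynomial.C ((d₀ : ℤ) : ℤ_[p]) : Polynomial ℤ_[p]) →+* 𝓞_ℂ_[p])
                    (_ : ι.comp (algebraMap ℤ_[p] _) = R1.toCpInt p),
                    ∃ m : ℕ, ∀ x ∈ (charIdeal (PowerSeries
                        (AdjoinRoot (Polynomial.X ^ 2 - Polynomial.C ((d₀ : ℤ) : ℤ_[p]) : Polynomial ℤ_[p])))
                        (WithQuadratic (LocNilDual (selmerOver (κ.kerSubgroup ⊓ U) ((W.baseChange K).geomPrimaryTorsion p)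
                          p 𝔭' ∅) f₁ h) b hb0 hb1 δ
                          (delta_sq (W.baseChange K) κ 𝔭' ∅ U φ hφH' hφU hφU' d₀ hφ2 f₁ h δ hδ))).map (PowerSeries.map ι),
                      (PowerSeries.C ((p : ℕ) : 𝓞_ℂ_[p]) : PowerSeries 𝓞_ℂ_[p]) ^ m * x ∈ Ideal.span {G})
    (W : WeierstrassCurve ℚ) [W.IsElliptic] [W.IsGloballyMinimal]
    [Fact (Nat.Prime 3)] (hCM : W.HasCM) (hr : W.analyticRank = 1)
    (hin : Literature.NumberTheory.EllipticCurves.Rank1Residual.CMInert W 3)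
    (hbad : ¬ Literature.NumberTheory.EllipticCurves.Rank1Residual.Good W 3) :
    Literature.NumberTheory.EllipticCurves.BSDp W 3 :=
  Summit.BirchSwinnertonDyer.BirchSwinnertonDyer.Theorems.InertBadSignedBranchesInertBadAtThreeOfKatzLineDivisibility.bsdp_three_of_print_of_katzLineDivisibilityAtThree
    hGZ hKo hMN hGZK hnf hFH hCM8 hCassels h8 h9 h10 hBT hMon hSmith
    hBV hMaz hAU hCes hKatz
    Summit.BirchSwinnertonDyer.BirchSwinnertonDyer.Theorems.BiquadraticEisensteinDescentDeuringOfCore.Deuring_exists_heckeCharacter_of_maximalCM_holds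
    hV4K W hCM hr hin hbad

/-- **The crux `InertBadSignedBranches.InertBadAtThree` BY NAME, MODULO nineteen named print facts and V4K@3** —
`inertBadAtThree_of_print_of_katzLineDivisibilityAtThree` (p640483) with Deuring's theorem supplied by
`Deuring_exists_heckeCharacter_of_maximalCM_holds`: crux 19225's conditional closure of record, PRINT{19} + RESEARCH{V4K@3}.
[cite: Hsieh2014JAMS, Thm. 8.14] [cite: Katz1978, Thm. (5.3.0)] -/
theorem inertBadAtThree_of_print_of_katzLineDivisibilityAtThree_of_katz
    (hGZ : ∀ (N : ℕ) [NeZero N] (W : WeierstrassCurve ℚ) (K : Type) [Field K] [NumberField K],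
      Literature.NumberTheory.EllipticCurves.gross_zagier N W K)
    (hKo : ∀ (N : ℕ) [NeZero N] (W : WeierstrassCurve ℚ) (K : Type) [Field K] [NumberField K],
      Literature.NumberTheory.EllipticCurves.kolyvagin N W K)
    (hMN : ∀ (N : ℕ) [NeZero N] (W : WeierstrassCurve ℚ) (K : Type) [Field K] [NumberField K],
      Literature.NumberTheory.EllipticCurves.MatarNekovar2019.thm03_padicValNat_card_sha_le_of_irreducible N W K)
    (hGZK : Literature.NumberTheory.EllipticCurves.rank_eq_analyticRank_of_analyticRank_le_one)
    (hnf : Literature.NumberTheory.EllipticCurves.ModularForms.exists_isNewformOf)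
    (hFH : Literature.NumberTheory.EllipticCurves.friedbergHoffstein_exists_heegnerField_split_twist_ne_zero)
    (hCM8 : Literature.NumberTheory.EllipticCurves.bsdTriple_of_hasCM_of_L_one_ne_zero)
    (hCassels : WeierstrassCurve.bsdRHS_eq_of_isIsogenous)
    (h8 : Literature.NumberTheory.EllipticCurves.Hsieh2014.thmA_exists_isHsiehLFunction_unrPeriod_anyLevel)
    (h9 : Literature.NumberTheory.EllipticCurves.Hsieh2014.thmB_exists_isHsiehLFunction_coeff_norm_eq_one_unrPeriod_anyLevel)
    (h10 : Literature.NumberTheory.EllipticCurves.LiuZhangZhang2018.thm151_thm153_modularCurve_heegnerVector_additive)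
    (hBT : Literature.NumberTheory.EllipticCurves.burungaleTian_analyticRank_eq_zero_of_selmerCorank_eq_zero_of_hasCM)
    (hMon : Literature.NumberTheory.EllipticCurves.monsky_selmerCorank_two_mod_two_eq)
    (hSmith : ∀ (W : WeierstrassCurve ℚ) [W.IsElliptic], W.HasCM →
      Literature.NumberTheory.EllipticCurves.smith_selmerCorank_density W)
    (hBV : Literature.NumberTheory.QuadraticFields.bv_threeTorsion_mean_imaginary_heegnerOdd)
    (hMaz : Literature.NumberTheory.EllipticCurves.ModularForms.mazur_not_dvd_maninConstant_of_odd)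
    (hAU : Literature.NumberTheory.EllipticCurves.ModularForms.abbesUllmo_not_dvd_maninConstant_of_not_dvd_level)
    (hCes : Literature.NumberTheory.EllipticCurves.ModularForms.cesnavicius_not_two_dvd_maninConstant_of_two_dvd_level)
    (hKatz : Literature.NumberTheory.EllipticCurves.hsieh2014mu_prop49_exists_isMeasure)
    (hV4K :
    ∀ (W : WeierstrassCurve ℚ) [W.IsElliptic] [W.IsGloballyMinimal] (p : ℕ) [Fact p.Prime]
      [NeZero (W.conductorNorm ℤ)] (K : Type) [Field K] [NumberField K],
      W.HasCM → p = 3 → CMInert W p → ¬ Good W p →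
      IsImaginaryQuadratic K → SatisfiesHeegnerHypothesis (W.conductorNorm ℤ) K →
      4 < (NumberField.discr K).natAbs → ¬ p ∣ NumberField.classNumber K →
      ∀ (κ : ZpExtension K p), κ.IsAnticyclotomic →
        ∀ (γ : Field.absoluteGaloisGroup K) [Fact (κ.IsTopGenerator γ)]
          (𝔭 : HeightOneSpectrum (𝓞 K)), ((p : ℕ) : 𝓞 K) ∈ 𝔭.asIdeal →
          𝔭.asIdeal.ramificationIdx (𝓞 ℚ) = 1 → 𝔭.asIdeal.inertiaDeg (𝓞 ℚ) = 1 →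
          ∀ (f : CuspForm (CongruenceSubgroup.Gamma0 (W.conductorNorm ℤ)) 2), IsNewformOf W f →
            ∀ (ι' : PadicAlgCl p ≃+* ℂ),
              (∀ (w : InfinitePlace K) (k : 𝓞 K), k ∈ 𝔭.asIdeal ↔ ‖ι'.symm (w.embedding (k : K))‖ < 1) →
                  ∀ (𝔭' : HeightOneSpectrum (𝓞 K)), ((p : ℕ) : 𝓞 K) ∈ 𝔭'.asIdeal → 𝔭' ≠ 𝔭 →
                  Module.IsTorsion (IwasawaAlgebra p) (XAc (W.baseChange K) p κ 𝔭' ∅ γ) →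
                  ∀ (L : Type) [Field L] [NumberField L] [Algebra K L] [IsGalois K L]
                    (Sp S T : Finset (HeightOneSpectrum (𝓞 L))) (lam : HeckeCharacter L) (ϑ : L) (CK : ℂ)
                    (Ω : InfinitePlace L → ℂ) (ΩpK : InfinitePlace L → ℂ_[p]) (G : PowerSeries 𝓞_ℂ_[p])
                    (w₁ w₂ : InfinitePlace L) (cL cL' : ℂ),
                    w₁ ≠ w₂ → (∀ w : InfinitePlace L, w = w₁ ∨ w = w₂) →
                    (∀ (χ : HeckeCharacter K) (n : ℕ), 0 < n → (∀ v : HeightOneSpectrum (𝓞 K), χ.IsUnramifiedAt v) →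
                      χ.HasInfinityType (fun _ ↦ (n : ℤ)) (fun _ ↦ -(n : ℤ)) →
                      KatzCM.HasKatzType ι' Sp (lam * χ.compRelNorm L) 1 (fun w ↦ if w = w₁ then n else n - 1)) →
                    (∀ (χ : HeckeCharacter K) (n : ℕ), 0 < n → (∀ v : HeightOneSpectrum (𝓞 K), χ.IsUnramifiedAt v) →
                      χ.HasInfinityType (fun _ ↦ (n : ℤ)) (fun _ ↦ -(n : ℤ)) →
                      LFunction.HasEntireContinuation (heckeLFunction (lam * χ.compRelNorm L))) →
                    cL ≠ 0 → cL' ≠ 0 →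
                    (∀ (χ : HeckeCharacter K) (n : ℕ), 0 < n → (∀ v : HeightOneSpectrum (𝓞 K), χ.IsUnramifiedAt v) →
                      χ.HasInfinityType (fun _ ↦ (n : ℤ)) (fun _ ↦ -(n : ℤ)) →
                      ∀ hL : LFunction.HasEntireContinuation (heckeLFunction (lam * χ.compRelNorm L)),
                        hL.continuation 0 = cL * cL' ^ n * rankinSelbergValueHecke f χ 1) →
                    (∀ w ∈ S ∪ KatzCM.primesOver L p, ¬ lam.IsUnramifiedAt w) →
                    (∀ w ∈ Sp ∪ T, ¬ lam.IsUnramifiedAt w) →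
                    CK ≠ 0 → (∀ w, Ω w ≠ 0) → (∀ w, (KatzCM.embeddingAt ι' Sp w ϑ).im ≠ 0) → (∀ w, ΩpK w ≠ 0) →
                    KatzCM.IsBaseChangeLine ι' Sp S T κ γ lam ϑ CK Ω ΩpK G →
                  ∀ (d₀ : ℤ) (r : AlgebraicClosure K) (ψ : (W.baseChange K).geomPoints →+ (W.baseChange K).geomPoints),
                    r * r = algebraMap K (AlgebraicClosure K) (d₀ : K) →
                    r ∉ Set.range (algebraMap K (AlgebraicClosure K)) →
                    (∀ y : ZMod p, y * y ≠ PadicInt.toZMod ((d₀ : ℤ) : ℤ_[p])) →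
                    (∀ σ : absoluteGaloisGroup K, σ • r = r → ∀ P : (W.baseChange K).geomPoints, σ • ψ P = ψ (σ • P)) →
                    (∀ σ : absoluteGaloisGroup K, σ • r = -r → ∀ P : (W.baseChange K).geomPoints, σ • ψ P = -ψ (σ • P)) →
                    (∀ P, ψ (ψ P) = d₀ • P) →
                  ∀ (U : Subgroup (absoluteGaloisGroup K)) [U.Normal], (∀ σ, σ ∈ U ↔ σ • r = r) →
                  ∀ (φ : (W.baseChange K).geomPrimaryTorsion p →+ (W.baseChange K).geomPrimaryTorsion p)
                    (_ : ∀ m, ((φ m : (W.baseChange K).geomPrimaryTorsion p) : (W.baseChange K).geomPoints) = ψ m)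
                    (hφH' : ∀ (x : (κ.kerSubgroup ⊓ U : Subgroup (absoluteGaloisGroup K)))
                      (m : (W.baseChange K).geomPrimaryTorsion p), φ (x • m) = x • φ m)
                    (hφU : ∀ σ ∈ U, ∀ m : (W.baseChange K).geomPrimaryTorsion p, φ (σ • m) = σ • φ m)
                    (hφU' : ∀ σ, σ ∉ U → ∀ m : (W.baseChange K).geomPrimaryTorsion p, φ (σ • m) = -(σ • φ m))
                    (hφ2 : ∀ m, φ (φ m) = d₀ • m)
                    (γ' : absoluteGaloisGroup K) (_ : κ.IsTopGenerator γ') (_ : γ' ∈ U)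
                    (f₁ : AddMonoid.End (selmerOver (κ.kerSubgroup ⊓ U) ((W.baseChange K).geomPrimaryTorsion p) p 𝔭' ∅))
                    (_hf : ∀ s, ((f₁ s : selmerOver (κ.kerSubgroup ⊓ U) ((W.baseChange K).geomPrimaryTorsion p) p 𝔭' ∅) :
                      subgroupH1 (κ.kerSubgroup ⊓ U) ((W.baseChange K).geomPrimaryTorsion p)) =
                        conjH1 (κ.kerSubgroup ⊓ U) ((W.baseChange K).geomPrimaryTorsion p) γ' s)
                    (h : IsLocNil p (f₁ - 1))
                    (δ : LocNilDual (selmerOver (κ.kerSubgroup ⊓ U) ((W.baseChange K).geomPrimaryTorsion p) p 𝔭' ∅) f₁ h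
                      →ₗ[IwasawaAlgebra p]
                      LocNilDual (selmerOver (κ.kerSubgroup ⊓ U) ((W.baseChange K).geomPrimaryTorsion p) p 𝔭' ∅) f₁ h)
                    (hδ : ∀ (x : LocNilDual (selmerOver (κ.kerSubgroup ⊓ U) ((W.baseChange K).geomPrimaryTorsion p) p 𝔭' ∅) f₁ h)
                      (s t : selmerOver (κ.kerSubgroup ⊓ U) ((W.baseChange K).geomPrimaryTorsion p) p 𝔭' ∅),
                      (t : subgroupH1 (κ.kerSubgroup ⊓ U) ((W.baseChange K).geomPrimaryTorsion p)) =
                        resH1Hom (ContinuousMonoidHom.id _) φ hφH'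
                          (s : subgroupH1 (κ.kerSubgroup ⊓ U) ((W.baseChange K).geomPrimaryTorsion p)) → δ x s = x t)
                    (b : Module.Basis (Fin 2) ℤ_[p]
                      (AdjoinRoot (Polynomial.X ^ 2 - Polynomial.C ((d₀ : ℤ) : ℤ_[p]) : Polynomial ℤ_[p]))) (hb0 : b 0 = 1)
                    (hb1 : b 1 * b 1 = algebraMap ℤ_[p]
                      (AdjoinRoot (Polynomial.X ^ 2 - Polynomial.C ((d₀ : ℤ) : ℤ_[p]) : Polynomial ℤ_[p])) ((d₀ : ℤ) : ℤ_[p]))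
                    (ι : AdjoinRoot (Polynomial.X ^ 2 - Polynomial.C ((d₀ : ℤ) : ℤ_[p]) : Polynomial ℤ_[p]) →+* 𝓞_ℂ_[p])
                    (_ : ι.comp (algebraMap ℤ_[p] _) = R1.toCpInt p),
                    ∃ m : ℕ, ∀ x ∈ (charIdeal (PowerSeries
                        (AdjoinRoot (Polynomial.X ^ 2 - Polynomial.C ((d₀ : ℤ) : ℤ_[p]) : Polynomial ℤ_[p])))
                        (WithQuadratic (LocNilDual (selmerOver (κ.kerSubgroup ⊓ U) ((W.baseChange K).geomPrimaryTorsion p)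
                          p 𝔭' ∅) f₁ h) b hb0 hb1 δ
                          (delta_sq (W.baseChange K) κ 𝔭' ∅ U φ hφH' hφU hφU' d₀ hφ2 f₁ h δ hδ))).map (PowerSeries.map ι),
                      (PowerSeries.C ((p : ℕ) : 𝓞_ℂ_[p]) : PowerSeries 𝓞_ℂ_[p]) ^ m * x ∈ Ideal.span {G}) :
    InertBadSignedBranches.InertBadAtThree := by
  intro W _ _ _ hCM hr hin hbad _
  haveI : Finite W.sha := (hGZK W hr.le).2
  exact Literature.NumberTheory.EllipticCurves.Rank1Residual.Typed.missingPPartAt_of_bsdp W 3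
    (bsdp_three_of_print_of_katzLineDivisibilityAtThree_of_katz hGZ hKo hMN hGZK hnf hFH hCM8 hCassels h8 h9 h10 hBT hMon
      hSmith hBV hMaz hAU hCes hKatz hV4K W hCM hr hin hbad)

end Summit.BirchSwinnertonDyer.BirchSwinnertonDyer.Theorems.InertBadSignedBranchesInertBadAtThreeOfKatzLineDivisibilityOfKatz

end
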